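import Mathlib
import HarnessLib
import Summits.HubbardSuperconductivity.HubbardSuperconductivity.Theorems.KLProgrammeKLRegimeSectorSliceGram

/-!
# Route `KLProgramme` — ENGINE child gen 6 (stmt-HubbardSuperconductivity-20236 `KLRegimeEngineV16`), `stub_engine_step_values` (E2-v10):
# the GRAM DATA of the hybrid bridge from one per-sector support count — the currency adapter between k3c2-p3's
# `isGramBoundedR_sectorSub_normalCovariance_of_count` (replica-Gram constant) and p5 g5's `…WickCrossContractionGramValue/Sized/Aniso`
# (hypotheses `‖sectorGramF … p Y‖ ≤ κ` on charge-`0` legs, `‖sectorGramG … p Y‖ ≤ κ` on charge-`1` legs)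
# (cell gate-hubbard-kl, seat p5 g5)

k3c2-p3's Gram suppliers (…SectorSliceGram, …SectorSliceGramFat, …SectorSliceGramRegime) state `IsGramBoundedR (S(F)ᵀ·C·S(F)) κ` with
`κ = √(‖(βL²)⁻¹‖²·(Ns·P))`; their proof goes through the EXPLICIT Gram vectors `sectorGramF/G` of BGM (2.80).  The factorial-free bridge of this seat
consumes the explicit half-norm bounds (its line determinants have rows from DIFFERENT covariances, so a determinant bound per covariance is not enough).
Here the half-norm bounds are exported under exactly k3c2-p3's count hypothesis, with the SAME constant:

* **`norm_sectorGramF_le_of_count`**, **`norm_sectorGramG_le_of_count`** — `‖p‖ ≤ P`, `‖F_ω‖ ≤ 1`, every joint support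
  `{k : F_ω(k) ≠ 0 ∧ p(k,σ) ≠ 0}` of at most `Ns` points ⇒ `‖F_Y‖, ‖G_Y‖ ≤ √(‖(βL²)⁻¹‖²·(Ns·P))` for EVERY label (no charge condition needed).

So every `κ_i` asked by `norm_kernel_crossContract_value_sectorPreimage_le_gram` and its companions is the replica-Gram constant k3c2-p3 already
certified for that line (slice lines: `gram_entry_klSliceCov_bgmFat_klEng`-type counts; soft lines: the same count with the soft symbol).
Proved; no definitions, no named facts.
-/

noncomputable section

namespace Summit.HubbardSuperconductivity.HubbardSuperconductivity.Theorems.TorusFourierL2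

set_option linter.dupNamespace false -- summit = problem name (single-conjunct summit), D-0017

open Finset Literature.MathematicalPhysics.QuantumLattice Literature.Probability.LatticeModels
open scoped InnerProductSpace

variable {L M N : ℕ} [NeZero L]

omit [NeZero L] in
/-- The pointwise phase-space weight `‖F_ω(k)‖²‖p(k,σ)‖ ≤ P` from `‖F_ω‖ ≤ 1`, `‖p‖ ≤ P`. [folklore] -/
private theorem normSq_mul_norm_le_of_le_one (F : Fin N → FreqMomentum L M → ℂ) (hF : ∀ ω k, ‖F ω k‖ ≤ 1)
    (p : FreqMomentum L M × Fin 2 → ℂ) {P : ℝ} (hp : ∀ ks, ‖p ks‖ ≤ P) (ω : Fin N) (σ : Fin 2) (k : FreqMomentum L M) :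
    ‖F ω k‖ ^ 2 * ‖p (k, σ)‖ ≤ P := by
  have h1 : ‖F ω k‖ ^ 2 ≤ 1 := by
    have := hF ω k
    nlinarith [norm_nonneg (F ω k)]
  calc ‖F ω k‖ ^ 2 * ‖p (k, σ)‖ ≤ 1 * P := mul_le_mul h1 (hp (k, σ)) (norm_nonneg _) zero_le_one
    _ = P := one_mul P

/-- **The left Gram half-norm from one per-sector count** (BGM 2006 (2.80) at finite `(β, L)`): if `‖p‖ ≤ P`, `‖F_ω‖ ≤ 1` and every joint support
`{k : F_ω(k) ≠ 0 ∧ p(k,σ) ≠ 0}` has at most `Ns` points, then `‖F_Y‖ ≤ √(‖(βL²)⁻¹‖²·(Ns·P))` for every label `Y` — the replica-Gram constant of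
`isGramBoundedR_sectorSub_normalCovariance_of_count`. [cite: BenfattoGiulianiMastropietro2006, §2.8 (2.80)] -/
theorem norm_sectorGramF_le_of_count [NeZero M] (β : ℝ) (F : Fin N → FreqMomentum L M → ℂ) (hF : ∀ ω k, ‖F ω k‖ ≤ 1)
    (p : FreqMomentum L M × Fin 2 → ℂ) {P : ℝ} (hP0 : 0 ≤ P) (hp : ∀ ks, ‖p ks‖ ≤ P) {Ns : ℝ}
    (hN : ∀ (ω : Fin N) (σ : Fin 2),
      (((univ : Finset (FreqMomentum L M)).filter fun k => F ω k ≠ 0 ∧ p (k, σ) ≠ 0).card : ℝ) ≤ Ns)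
    (Y : SpaceTimeIdx L M × SectorLeg N) :
    ‖sectorGramF L M β F p Y‖ ≤ Real.sqrt (‖((1 / (β * (L : ℝ) ^ 2) : ℝ) : ℂ)‖ ^ 2 * (Ns * P)) := by
  classical
  set T := (univ : Finset (FreqMomentum L M)).filter fun k => F Y.2.1.1 k ≠ 0 ∧ p (k, Y.2.1.2) ≠ 0 with hT
  have h := norm_sq_sectorGramF_le (L := L) (M := M) β F p Y (S := P) (fun k => normSq_mul_norm_le_of_le_one F hF p hp Y.2.1.1 Y.2.1.2 k) T
    (fun k h1 h2 => by rw [hT, mem_filter]; exact ⟨mem_univ _, h1, h2⟩)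
  have hsq : ‖sectorGramF L M β F p Y‖ ^ 2 ≤ ‖((1 / (β * (L : ℝ) ^ 2) : ℝ) : ℂ)‖ ^ 2 * (Ns * P) :=
    h.trans (mul_le_mul_of_nonneg_left (mul_le_mul_of_nonneg_right (hN Y.2.1.1 Y.2.1.2) hP0) (by positivity))
  rw [← Real.sqrt_sq (norm_nonneg (sectorGramF L M β F p Y))]
  exact Real.sqrt_le_sqrt hsq

/-- **The right Gram half-norm from the same count**: `‖G_{Y'}‖ ≤ √(‖(βL²)⁻¹‖²·(Ns·P))` for every label `Y'`.
[cite: BenfattoGiulianiMastropietro2006, §2.8 (2.80)] -/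
theorem norm_sectorGramG_le_of_count [NeZero M] (β : ℝ) (F : Fin N → FreqMomentum L M → ℂ) (hF : ∀ ω k, ‖F ω k‖ ≤ 1)
    (p : FreqMomentum L M × Fin 2 → ℂ) {P : ℝ} (hP0 : 0 ≤ P) (hp : ∀ ks, ‖p ks‖ ≤ P) {Ns : ℝ}
    (hN : ∀ (ω : Fin N) (σ : Fin 2),
      (((univ : Finset (FreqMomentum L M)).filter fun k => F ω k ≠ 0 ∧ p (k, σ) ≠ 0).card : ℝ) ≤ Ns)
    (Y' : SpaceTimeIdx L M × SectorLeg N) :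
    ‖sectorGramG L M β F p Y'‖ ≤ Real.sqrt (‖((1 / (β * (L : ℝ) ^ 2) : ℝ) : ℂ)‖ ^ 2 * (Ns * P)) := by
  classical
  set T := (univ : Finset (FreqMomentum L M)).filter fun k => F Y'.2.1.1 k ≠ 0 ∧ p (k, Y'.2.1.2) ≠ 0 with hT
  have h := norm_sq_sectorGramG_le (L := L) (M := M) β F p Y' (S := P) (fun k => normSq_mul_norm_le_of_le_one F hF p hp Y'.2.1.1 Y'.2.1.2 k) T
    (fun k h1 h2 => by rw [hT, mem_filter]; exact ⟨mem_univ _, h1, h2⟩)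
  have hsq : ‖sectorGramG L M β F p Y'‖ ^ 2 ≤ ‖((1 / (β * (L : ℝ) ^ 2) : ℝ) : ℂ)‖ ^ 2 * (Ns * P) :=
    h.trans (mul_le_mul_of_nonneg_left (mul_le_mul_of_nonneg_right (hN Y'.2.1.1 Y'.2.1.2) hP0) (by positivity))
  rw [← Real.sqrt_sq (norm_nonneg (sectorGramG L M β F p Y'))]
  exact Real.sqrt_le_sqrt hsq

end Summit.HubbardSuperconductivity.HubbardSuperconductivity.Theorems.TorusFourierL2

end
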